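import Summits.AnomalousDissipation.AnomalousDissipation.Theorems.MomentParityQuarticGateKernel

/-!
# Order-3 surgery for `MomentParity.QuarticGate` (stmt-AnomalousDissipation-11464), helper VII:
# the assembly, conditional on the band-basis infrastructure ("Assembly")

Support file for the stub `stub_order3Surgery` of the line `recession-cone` (S5).
`order3Surgery_of` proves the conclusion of the stub — a level-`N` probability law `μ₁` with finite
fourth moments, SLATER in degree `4` (band form), 3-STATIONARY, with the energy and dissipation of
`μ₀` — from the hypotheses of the stub on `μ₀` plus, AS HYPOTHESES, the band-basis infrastructure of
the CONTRACT (coordinates onto / Parseval / band expansion = I2, REALIZE = I3, ROW POLYNOMIAL = I4,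
dissipation polynomial = I5), in the vocabulary `IsLevel` / `IsBandTest` / `polyGrad` /
`IsPolyStationary` of `Theorems/QuarticGate/Negative/LevelCeiling.lean` (definitional unfoldings
of the crux clauses). The stub itself is then `order3Surgery_of` fed with the infrastructure
theorems (file `…Order3Surgery.lean`).

Proof: `y_Λ` from `exists_shifted_sequence` (Kernel); `μ₁ := REALIZE(y_Λ)`; every test `(g, P)`
is transported to the basis (`Rows`), split into its quadratic top (row killed by the shift) and a
test of degree `≤ 1` (constant differential: a fixed band field, whose `μ₁`-row is its `μ₀`-row,
zero by hypothesis), energy and dissipation are Riesz functionals of degree-`2` polynomials, on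
which `y_Λ = y₀`.
-/

-- `Summit.<Summit>.<Problem>` is the tree's mandated summit-side namespace (CONVENTIONS §2); for this
-- single-conjunct summit the two coincide, so the duplicate is deliberate.
set_option linter.dupNamespace false

namespace Summit.AnomalousDissipation.AnomalousDissipation.Theorems.MomentParityQuarticGate

open scoped BigOperators InnerProductSpace RealInnerProductSpace ENNReal
open MeasureTheory MvPolynomial Literature.MeasureTheory.Moments
open Literature.Analysis.FunctionSpaces Literature.Analysis.FluidPDE
open Summit.AnomalousDissipation.AnomalousDissipation.Theorems.QuarticGate.Negative

/-! ## Small bookkeeping -/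

/-- `Σᵢ Xᵢ²` has degree `≤ 2` and evaluates to `Σᵢ xᵢ²`. [folklore] -/
theorem totalDegree_sum_X_sq_le (n : ℕ) :
    (∑ i, (X i : MvPolynomial (Fin n) ℝ) ^ 2).totalDegree ≤ 2 :=
  totalDegree_finsetSum_le fun i _ => (totalDegree_pow _ _).trans (by rw [totalDegree_X])

/-- The lower part `P - P₂` of a polynomial of degree `≤ 2` has degree `≤ 1`. [folklore] -/
theorem totalDegree_sub_homogeneousComponent_two_le {n : ℕ} (P : MvPolynomial (Fin n) ℝ)
    (hP : P.totalDegree ≤ 2) : (P - homogeneousComponent 2 P).totalDegree ≤ 1 :=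
  Finset.sup_le fun β hβ => by
    have h := degree_le_of_mem_support_sub_homogeneousComponent P hP hβ
    have h' := finsupp_degree_eq_sum β
    change (β.sum fun _ e => e) ≤ 1
    omega

/-- The mean enstrophy of a level-`N` law is the mean of the dissipation polynomial. [folklore] -/
theorem toReal_lintegral_eGradNormSq_eq :
    ∀ {N n : ℕ} {b : Fin n → UnitAddTorus (Fin 3) → EuclideanSpace ℝ (Fin 3)} (D : MvPolynomial (Fin
      n) ℝ), (∀ u : Torus.energySpace (Fin 3), IsLevel N u → (Torus.eGradNormSq (u.1 : UnitAddTorus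
      (Fin 3) → EuclideanSpace ℝ (Fin 3))).toReal = MvPolynomial.eval (fun i => Torus.pairing u.1 (b
      i)) D) → ∀ (μ : Measure (Torus.energySpace (Fin 3))), (∀ᵐ u ∂μ, IsLevel N u) → Integrable (fun
      u : Torus.energySpace (Fin 3) => MvPolynomial.eval (fun i => Torus.pairing u.1 (b i)) D) μ →
      (∫⁻ u, Torus.eGradNormSq ((u : Torus.energySpace (Fin 3)).1 : UnitAddTorus (Fin 3) →
      EuclideanSpace ℝ (Fin 3)) ∂μ).toReal = ∫ u, MvPolynomial.eval (fun i => Torus.pairing u.1 (b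
      i)) D ∂μ := by
  intro N n b D hD μ hl hint
  have hfin : ∀ u : Torus.energySpace (Fin 3), IsLevel N u →
      Torus.eGradNormSq (u.1 : UnitAddTorus (Fin 3) → EuclideanSpace ℝ (Fin 3)) ≠ ∞ := fun u hu =>
    ((eGradNormSq_le_of_level u.1 hu).trans_lt
      (ENNReal.mul_lt_top ENNReal.ofReal_lt_top (ENNReal.pow_lt_top enorm_lt_top))).ne
  have hae : (fun u : Torus.energySpace (Fin 3) =>
      Torus.eGradNormSq (u.1 : UnitAddTorus (Fin 3) → EuclideanSpace ℝ (Fin 3))) =ᵐ[μ]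
      fun u => ENNReal.ofReal (eval (fun i => Torus.pairing u.1 (b i)) D) :=
    hl.mono fun u hu => by
      dsimp only
      rw [← hD u hu, ENNReal.ofReal_toReal (hfin u hu)]
  have hnn : 0 ≤ᵐ[μ] fun u : Torus.energySpace (Fin 3) => eval (fun i => Torus.pairing u.1 (b i)) D :=
    hl.mono fun u hu => by
      dsimp only
      rw [Pi.zero_apply, ← hD u hu]
      exact ENNReal.toReal_nonneg
  rw [lintegral_congr_ae hae, ← ofReal_integral_eq_lintegral_ofReal hint hnn,
    ENNReal.toReal_ofReal (integral_nonneg_of_ae hnn)]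

/-! ## The assembly -/

/-- **Order-3 surgery + Slater upgrade, conditional form.** See the module docstring. All
infrastructure enters as hypotheses (`hsumband`, `horth`, `hpb`, `hgb`, `hlev`, `hnorm` = I2;
`hReal` = I3; `hRow` = I4; `hDiss` = I5), the remaining hypotheses are those of the stub
`stub_order3Surgery` (in the `IsLevel`/`IsBandTest`/`polyGrad` vocabulary). [folklore] -/
theorem order3Surgery_of :
    ∀ {N n : ℕ} {b : Fin n → UnitAddTorus (Fin 3) → EuclideanSpace ℝ (Fin 3)}, (∀ i, IsBandTest N (b
      i)) → (∀ ξ : Fin n → ℝ, IsBandTest N (fun x => ∑ i, ξ i • b i x)) → (∀ (ξ : Fin n → ℝ) (i :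
      Fin n), ∫ y, ⟪∑ j, ξ j • b j y, b i y⟫_ℝ = ξ i) → (∀ g : UnitAddTorus (Fin 3) → EuclideanSpace
      ℝ (Fin 3), IsBandTest N g → ∀ u : Torus.energySpace (Fin 3), Torus.pairing u.1 g = ∑ i, (∫ y,
      ⟪g y, b i y⟫_ℝ) * Torus.pairing u.1 (b i)) → (∀ g : UnitAddTorus (Fin 3) → EuclideanSpace ℝ
      (Fin 3), IsBandTest N g → ∀ x, g x = ∑ i, (∫ y, ⟪g y, b i y⟫_ℝ) • b i x) → (∀ x : Fin n → ℝ, ∃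
      u : Torus.energySpace (Fin 3), IsLevel N u ∧ (fun i => Torus.pairing u.1 (b i)) = x) → (∀ u :
      Torus.energySpace (Fin 3), IsLevel N u → ‖u‖ ^ 2 = ∑ i, (Torus.pairing u.1 (b i)) ^ 2) → ∀ (ν
      : ℝ) {f : UnitAddTorus (Fin 3) → EuclideanSpace ℝ (Fin 3)}, Torus.IsSmooth f → (∀ y : (Fin n
      →₀ ℕ) → ℝ, y 0 = 1 → Literature.MeasureTheory.Moments.IsStrictlyKPositive (Set.univ : Set (Fin
      n → ℝ)) 4 y → ∃ μ : Measure (Torus.energySpace (Fin 3)), IsProbabilityMeasure μ ∧ (∀ᵐ u ∂μ,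
      IsLevel N u) ∧ Integrable (fun u : Torus.energySpace (Fin 3) => ‖u‖ ^ 4) μ ∧ ∀ Q :
      MvPolynomial (Fin n) ℝ, Q.totalDegree ≤ 4 → Integrable (fun u : Torus.energySpace (Fin 3) =>
      MvPolynomial.eval (fun i => Torus.pairing u.1 (b i)) Q) μ ∧ ∫ u, MvPolynomial.eval (fun i =>
      Torus.pairing u.1 (b i)) Q ∂μ = Literature.MeasureTheory.Moments.rieszFunctional y Q) → (∀ (m
      : ℕ) (g : Fin m → UnitAddTorus (Fin 3) → EuclideanSpace ℝ (Fin 3)), (∀ i, IsBandTest N (g i))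
      → ∀ (P : MvPolynomial (Fin m) ℝ) (d : ℕ), P.totalDegree ≤ d → ∃ Q : MvPolynomial (Fin n) ℝ,
      Q.totalDegree ≤ d + 1 ∧ (∀ u : Torus.energySpace (Fin 3), IsLevel N u →
      Torus.nsGeneratorPairing ν f u (polyGrad g P u) = MvPolynomial.eval (fun i => Torus.pairing
      u.1 (b i)) Q) ∧ (∀ u : Torus.energySpace (Fin 3), IsLevel N u → MvPolynomial.eval (fun i =>
      Torus.pairing u.1 (b i)) (MvPolynomial.homogeneousComponent (d + 1) Q) =
      Torus.nsGeneratorPairing (d := Fin 3) 0 0 u (polyGrad g (MvPolynomial.homogeneousComponent d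
      P) u))) → (∃ D : MvPolynomial (Fin n) ℝ, D.totalDegree ≤ 2 ∧ ∀ u : Torus.energySpace (Fin 3),
      IsLevel N u → (Torus.eGradNormSq (u.1 : UnitAddTorus (Fin 3) → EuclideanSpace ℝ (Fin
      3))).toReal = MvPolynomial.eval (fun i => Torus.pairing u.1 (b i)) D) → ∀ (μ₀ : Measure
      (Torus.energySpace (Fin 3))) [IsProbabilityMeasure μ₀], (∀ᵐ u ∂μ₀, IsLevel N u) → (∃ R : ℝ, ∀ᵐ
      u ∂μ₀, ‖u‖ ≤ R) → (∀ g : UnitAddTorus (Fin 3) → EuclideanSpace ℝ (Fin 3), IsBandTest N g → (∃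
      u : Torus.energySpace (Fin 3), IsLevel N u ∧ Torus.pairing u.1 g ≠ 0) → (∫ u, Torus.pairing
      u.1 g ∂μ₀) ^ 2 < ∫ u, (Torus.pairing u.1 g) ^ 2 ∂μ₀) → (∀ g : UnitAddTorus (Fin 3) →
      EuclideanSpace ℝ (Fin 3), IsBandTest N g → Integrable (fun u : Torus.energySpace (Fin 3) =>
      Torus.nsGeneratorPairing ν f u g) μ₀ ∧ ∫ u, Torus.nsGeneratorPairing ν f u g ∂μ₀ = 0) →
      (Integrable (fun u : Torus.energySpace (Fin 3) => Torus.nsGeneratorPairing ν f u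
      (Torus.fourierTruncate N (u.1 : UnitAddTorus (Fin 3) → EuclideanSpace ℝ (Fin 3)))) μ₀ ∧ ∫ u,
      Torus.nsGeneratorPairing ν f u (Torus.fourierTruncate N (u.1 : UnitAddTorus (Fin 3) →
      EuclideanSpace ℝ (Fin 3))) ∂μ₀ = 0) → (Integrable (fun u : Torus.energySpace (Fin 3) =>
      Torus.nsGeneratorPairing ν f u (BDSV.curl (Torus.fourierTruncate N (u.1 : UnitAddTorus (Fin 3)
      → EuclideanSpace ℝ (Fin 3))))) μ₀ ∧ ∫ u, Torus.nsGeneratorPairing ν f u (BDSV.curl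
      (Torus.fourierTruncate N (u.1 : UnitAddTorus (Fin 3) → EuclideanSpace ℝ (Fin 3)))) ∂μ₀ = 0) →
      (∀ (m : ℕ) (g : Fin m → UnitAddTorus (Fin 3) → EuclideanSpace ℝ (Fin 3)) (P : MvPolynomial
      (Fin m) ℝ), (∀ i, IsBandTest N (g i)) → P.IsHomogeneous 2 → (∀ u : Torus.energySpace (Fin 3),
      IsLevel N u → Torus.nsGeneratorPairing (d := Fin 3) 0 0 u (polyGrad g P u) = 0) → ∃ α β : ℝ, ∀
      u : Torus.energySpace (Fin 3), IsLevel N u → ∀ x, polyGrad g P u x = (2 * α) •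
      Torus.fourierTruncate N (u.1 : UnitAddTorus (Fin 3) → EuclideanSpace ℝ (Fin 3)) x + (2 * β) •
      BDSV.curl (Torus.fourierTruncate N (u.1 : UnitAddTorus (Fin 3) → EuclideanSpace ℝ (Fin 3))) x)
      → ∃ μ₁ : Measure (Torus.energySpace (Fin 3)), IsProbabilityMeasure μ₁ ∧ (∀ᵐ u ∂μ₁, IsLevel N
      u) ∧ Integrable (fun u : Torus.energySpace (Fin 3) => ‖u‖ ^ 4) μ₁ ∧ (∀ (m : ℕ) (g : Fin m →
      UnitAddTorus (Fin 3) → EuclideanSpace ℝ (Fin 3)) (P : MvPolynomial (Fin m) ℝ), (∀ i,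
      IsBandTest N (g i)) → P.totalDegree ≤ 4 → (∀ u : Torus.energySpace (Fin 3), IsLevel N u → 0 ≤
      MvPolynomial.eval (fun j => Torus.pairing u.1 (g j)) P) → (∃ u : Torus.energySpace (Fin 3),
      IsLevel N u ∧ MvPolynomial.eval (fun j => Torus.pairing u.1 (g j)) P ≠ 0) → 0 < ∫ u,
      MvPolynomial.eval (fun j => Torus.pairing u.1 (g j)) P ∂μ₁) ∧ IsPolyStationary ν f N 3 μ₁ ∧
      Torus.ensembleEnergy μ₁ = Torus.ensembleEnergy μ₀ ∧ Torus.ensembleDissipation ν μ₁ =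
      Torus.ensembleDissipation ν μ₀ := by
  intro N n b hb hsumband horth hpb hgb hlev hnorm ν f hf hReal hRow hDiss μ₀ _ hl₀ hbdd hnd hlinrow hE hH hQuad
  classical
  have hbs : ∀ i, Torus.IsSmooth (b i) := fun i => (hb i).1
  have hlin : ∀ (u : Torus.energySpace (Fin 3)) (ξ : Fin n → ℝ),
      Torus.pairing u.1 (fun x => ∑ i, ξ i • b i x) = ∑ i, ξ i * Torus.pairing u.1 (b i) := by
    intro u ξ
    rw [hpb _ (hsumband ξ) u]
    simp_rw [horth ξ]
  -- the target sequence and the new law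
  obtain ⟨y₀, y, hmom, hy0, hypos, hyeq, hrows⟩ := exists_shifted_sequence hb hsumband hlin hlev ν hf
    μ₀ hl₀ hbdd hnd hE hH (fun P hP h0 => hQuad n b P hb hP h0) (fun P d hP => hRow n b hb P d hP)
  obtain ⟨μ₁, hp₁, hl₁, hi₁, hint⟩ := hReal y hy0 hypos
  have hyeq' : ∀ α : Fin n →₀ ℕ, α.degree ≤ 2 → y α = y₀ α := hyeq
  -- transport data of a band test family
  have htrans : ∀ (m : ℕ) (g : Fin m → UnitAddTorus (Fin 3) → EuclideanSpace ℝ (Fin 3)),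
      (∀ i, IsBandTest N (g i)) → ∀ P : MvPolynomial (Fin m) ℝ,
      (∀ u : Torus.energySpace (Fin 3), eval (fun j => Torus.pairing u.1 (g j)) P =
        eval (fun i => Torus.pairing u.1 (b i))
          (bind₁ (fun j => ∑ i, C (∫ y, ⟪g j y, b i y⟫_ℝ) * (X i : MvPolynomial (Fin n) ℝ)) P)) ∧
      (∀ u : Torus.energySpace (Fin 3), polyGrad g P u =
        polyGrad b (bind₁ (fun j => ∑ i, C (∫ y, ⟪g j y, b i y⟫_ℝ) * (X i : MvPolynomial (Fin n) ℝ)) P) u) :=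
    fun m g hg P =>
      ⟨fun u => eval_pairing_transport (fun j i => ∫ y, ⟪g j y, b i y⟫_ℝ) (fun u j => hpb _ (hg j) u) P u,
        fun u => funext fun x => polyGrad_transport (fun j i => ∫ y, ⟪g j y, b i y⟫_ℝ)
          (fun j x => hgb _ (hg j) x) (fun u j => hpb _ (hg j) u) P u x⟩
  refine ⟨μ₁, hp₁, hl₁, hi₁, ?_, ?_, ?_, ?_⟩
  · -- SLATER in degree 4, band form
    intro m g P hg hP4 hnn hex
    obtain ⟨hev, -⟩ := htrans m g hg P
    set P' := bind₁ (fun j => ∑ i, C (∫ y, ⟪g j y, b i y⟫_ℝ) * (X i : MvPolynomial (Fin n) ℝ)) P with hP'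
    have hdeg : P'.totalDegree ≤ 4 := (totalDegree_bind₁_linear_le _ P).trans hP4
    have hpos : 0 < rieszFunctional y P' := by
      refine hypos.2 P' hdeg (fun x _ => ?_) ?_
      · obtain ⟨u, hu, hux⟩ := hlev x
        rw [← hux, ← hev u]
        exact hnn u hu
      · obtain ⟨u, hu, hne⟩ := hex
        exact ⟨_, Set.mem_univ _, by rw [← hev u]; exact hne⟩
    simp_rw [hev]
    rw [(hint P' hdeg).2]
    exact hpos
  · -- 3-STATIONARITY
    intro m g P hg hP
    obtain ⟨-, hgrad⟩ := htrans m g hg P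
    set P' := bind₁ (fun j => ∑ i, C (∫ y, ⟪g j y, b i y⟫_ℝ) * (X i : MvPolynomial (Fin n) ℝ)) P with hP'
    have hdeg : P'.totalDegree ≤ 2 := (totalDegree_bind₁_linear_le _ P).trans (by omega)
    set P₂ := homogeneousComponent 2 P' with hP₂
    set P₁ := P' - homogeneousComponent 2 P' with hP₁
    have hP₂h : P₂.IsHomogeneous 2 := homogeneousComponent_isHomogeneous 2 P'
    have hP₁d : P₁.totalDegree ≤ 1 := totalDegree_sub_homogeneousComponent_two_le P' hdeg
    obtain ⟨Q₂, hQ₂deg, hQ₂row, -⟩ := hRow n b hb P₂ 2 hP₂h.totalDegree_le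
    obtain ⟨Q₁, hQ₁deg, hQ₁row, -⟩ := hRow n b hb P₁ 1 hP₁d
    -- the row integrand on level-`N` fields
    have hPsplit : P' = ∑ k : Fin 2, (1 : ℝ) • (![P₂, P₁] : Fin 2 → MvPolynomial (Fin n) ℝ) k := by
      rw [Fin.sum_univ_two]
      simp [hP₂, hP₁]
    have hsplit : ∀ u : Torus.energySpace (Fin 3), IsLevel N u →
        Torus.nsGeneratorPairing ν f u (polyGrad g P u) =
          eval (fun i => Torus.pairing u.1 (b i)) (Q₂ + Q₁) := fun u hu => by
      rw [hgrad u, hPsplit, nsGeneratorPairing_polyGrad_sum_smul ν hf hbs, Fin.sum_univ_two, map_add]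
      simp [hQ₂row u hu, hQ₁row u hu]
    have hQdeg : (Q₂ + Q₁).totalDegree ≤ 4 :=
      (totalDegree_add _ _).trans (max_le (hQ₂deg.trans (by norm_num)) (hQ₁deg.trans (by norm_num)))
    refine ⟨(hint _ hQdeg).1.congr (hl₁.mono fun u hu => (hsplit u hu).symm), ?_⟩
    rw [integral_congr_ae (hl₁.mono fun u hu => hsplit u hu), (hint _ hQdeg).2, rieszFunctional_add,
      hrows P₂ hP₂h Q₂ hQ₂deg hQ₂row, zero_add,
      rieszFunctional_congr_of_totalDegree_le (k := 2) hyeq' hQ₁deg, ← (hmom Q₁).2,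
      ← integral_congr_ae (hl₀.mono fun u hu => hQ₁row u hu)]
    -- the test of degree `≤ 1` has a constant differential: a fixed band field
    have hw : ∀ u : Torus.energySpace (Fin 3), polyGrad b P₁ u =
        fun x => ∑ i, P₁.coeff (Finsupp.single i 1) • b i x := fun u => by
      funext x
      unfold polyGrad
      simp_rw [pderiv_eq_C_of_totalDegree_le_one P₁ hP₁d, eval_C]
    simp_rw [hw]
    exact (hlinrow _ (hsumband _)).2
  · -- ENERGY
    have hev : ∀ u : Torus.energySpace (Fin 3), IsLevel N u →
        ‖u‖ ^ 2 = eval (fun i => Torus.pairing u.1 (b i)) (∑ i, (X i : MvPolynomial (Fin n) ℝ) ^ 2) :=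
      fun u hu => by rw [hnorm u hu]; simp [map_sum]
    unfold Torus.ensembleEnergy
    rw [integral_congr_ae (hl₁.mono fun u hu => hev u hu), integral_congr_ae (hl₀.mono fun u hu => hev u hu),
      (hint _ ((totalDegree_sum_X_sq_le n).trans (by norm_num))).2, (hmom _).2]
    exact rieszFunctional_congr_of_totalDegree_le (k := 2) hyeq' (totalDegree_sum_X_sq_le n)
  · -- DISSIPATION
    obtain ⟨D, hDdeg, hD⟩ := hDiss
    unfold Torus.ensembleDissipation Torus.ensembleEnstrophy
    rw [toReal_lintegral_eGradNormSq_eq D hD μ₁ hl₁ (hint D (hDdeg.trans (by norm_num))).1,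
      toReal_lintegral_eGradNormSq_eq D hD μ₀ hl₀ (hmom D).1, (hint D (hDdeg.trans (by norm_num))).2,
      (hmom D).2, rieszFunctional_congr_of_totalDegree_le (k := 2) hyeq' hDdeg]

end Summit.AnomalousDissipation.AnomalousDissipation.Theorems.MomentParityQuarticGate
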